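import Summits.CriticalPhenomena.SAWScalingLimit.Theses.SAWZoomRigidity
import HarnessLib

/-!
# Route `SAWZoomRigidity`: the assembly frame `Assembly` (item `stmt-CriticalPhenomena-6504`)

`Assembly := exists_isSLECurve → IsSLECurve.map_eq → LSWRestrictionFact → Rigidity → ZoomRigidity →
SubseqLimitAxioms → JointCompactness → ZoomInvariantLimitSet → SAWScalingLimit`.

Since rev 2 of the route (2026-08-15) the route file carries the sorry-free deciding theorem
`Summit.CriticalPhenomena.SAWScalingLimit.Theses.SAWZoomRigidity.closes :
ZoomRigidity → Rigidity → SubseqLimitAxioms → JointCompactness → ZoomInvariantLimitSet →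
SAWScalingLimit` (axioms `propext`, `Classical.choice`, `Quot.sound`), which uses the PROVED
Literature theorems `LawlerSchrammWerner2003_holds` (conformal restriction characterisation of
chordal SLE_{8/3}) and `IsSLECurve.map_eq_holds` (uniqueness in law) instead of the named facts.
The assembly frame is therefore `closes` with its three leading hypotheses (the all-κ SLE existence
fact `exists_isSLECurve`, uniqueness in law `IsSLECurve.map_eq`, and the support item
`LSWRestrictionFact`) discarded.  No named fact is used: the theorem below is unconditional.
-/

namespace Summit.CriticalPhenomena.SAWScalingLimit.Theorems

open Summit.CriticalPhenomena.SAWScalingLimit.Theses.SAWZoomRigidity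

/-- **The assembly frame of route `SAWZoomRigidity` holds** (item `stmt-CriticalPhenomena-6504`):
`exists_isSLECurve → IsSLECurve.map_eq → LSWRestrictionFact → Rigidity → ZoomRigidity →
SubseqLimitAxioms → JointCompactness → ZoomInvariantLimitSet → SAWScalingLimit`.
Immediate from the route's proved deciding theorem `closes` (zoom rigidity makes every joint
subsequential SAW limit dilation covariant, `Rigidity` makes it conformally covariant,
Lawler–Schramm–Werner 2003 identifies it as chordal SLE_{8/3}, and joint compactness plus
uniqueness in law upgrade the subsequential limit to the full scaling limit); the first three
hypotheses are not needed. [folklore] -/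
theorem zoomRigidity_assembly_proof :
    Summit.CriticalPhenomena.SAWScalingLimit.Theses.SAWZoomRigidity.Assembly := by
  unfold Summit.CriticalPhenomena.SAWScalingLimit.Theses.SAWZoomRigidity.Assembly
  intro _ _ _ hR hZ hS hJ hZI
  exact closes hZ hR hS hJ hZI

end Summit.CriticalPhenomena.SAWScalingLimit.Theorems
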